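import Mathlib
import Summits.KontsevichZagierPeriods.Zeta5Search.Families.SectorIntegrals
import Summits.KontsevichZagierPeriods.Zeta5Search.Families.SectorBounds
import HarnessLib

/-!
# ζ(5) search — Families: integrability of products of powers of point differences on the simplex (sufficiency)

HONEST FRAMING: systematic search; no irrationality claim unless certified.  This file contains NO statement about
zeta values.  It is file 4 of the ANALYTIC half of Brown's convergence criterion [Brown2016, §2.4, Lemma 3.6,
Def. 5.1] (seat P2): the SUFFICIENCY of the block criterion.

**Theorem** (`lintegral_powProd_lt_top_of_crit`, `integrableOn_powProd_of_crit`).  Let `E` be a finite family of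
edges between the finite marked points `0 = z₀ < t₁ < ⋯ < t_ℓ < 1` with real exponents `c`, and suppose the block
criterion `E.Crit c` holds (every run `R` of `1,…,ℓ` consecutive gaps has `|R| + Σ_{span i ⊆ R} c_i > 0`, i.e.
every cluster of `2,…,n−2` consecutive finite points carries total exponent `> −(#points − 1)`).  Then
`∏_i (z_{hi i} − z_{lo i})^{c_i}` is integrable on the open simplex.

Proof (Hepp sectors, files 1–3).  Cover the simplex by the `(ℓ+1)!` sectors on which the gaps are sorted along a
permutation `π`; on a sector the integrand is at most `Kup · ∏_w g_w^{A_π(w)}` (`EdgePowers`); pass to gap coordinates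
dropping the LARGEST gap `π(last)` (`GapCoordinates.lintegral_openSimplex_eq_gapSet_extGap`), whose power is bounded
since it lies in `[1/(ℓ+1), 1]`; relabel the remaining gaps by rank (`rankCoord`, a volume-preserving coordinate
permutation) to land in the ordered sector of `SectorIntegrals`, whose tail conditions are exactly block functionals
of the low-rank gap sets (`EdgePowers.psum_aggExp_eq_blockSum`), positive by `blockSum_pos_of_crit`.
The necessity of the criterion and the cellular dictionary (`BrownConvergent`) are in the sequel file.
Standard axioms only.
-/

noncomputable section

open MeasureTheory Set Finset ENNReal

namespace Summit.KontsevichZagierPeriods.Zeta5Search.Families.Cellular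

open Sector

variable {ℓ : ℕ}

/-! ### The coordinate relabelling attached to a rank permutation -/

/-- For a rank permutation `π` of the `ℓ+1` gaps, the relabelling `ρ` of the `ℓ` free gaps (those other than the
top-ranked gap `π(last)`) by rank: `(π last).succAbove (ρ k) = π (castSucc k)`. -/
def rankCoord (π : Equiv.Perm (Fin (ℓ + 1))) : Fin ℓ ≃ Fin ℓ :=
  ((finSuccAboveEquiv (Fin.last ℓ)).trans
    (π.subtypeEquiv fun _ => (π.injective.ne_iff).symm)).trans
    (finSuccAboveEquiv (π (Fin.last ℓ))).symm

/-- The defining property of `rankCoord`. -/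
theorem succAbove_rankCoord (π : Equiv.Perm (Fin (ℓ + 1))) (k : Fin ℓ) :
    (π (Fin.last ℓ)).succAbove (rankCoord π k) = π (Fin.castSucc k) := by
  show (π (Fin.last ℓ)).succAbove ((finSuccAboveEquiv (π (Fin.last ℓ))).symm
      ⟨π ((Fin.last ℓ).succAbove k), π.injective.ne (Fin.succAbove_ne _ _)⟩) = π (Fin.castSucc k)
  have h := congrArg Subtype.val ((finSuccAboveEquiv (π (Fin.last ℓ))).apply_symm_apply
    ⟨π ((Fin.last ℓ).succAbove k), π.injective.ne (Fin.succAbove_ne _ _)⟩)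
  rw [finSuccAboveEquiv_apply] at h
  dsimp only at h
  rw [h, Fin.succAbove_last]

/-- Composition with the relabelling, as a measurable equivalence of `ℝ^ℓ`. -/
def compRankCoord (π : Equiv.Perm (Fin (ℓ + 1))) : (Fin ℓ → ℝ) ≃ᵐ (Fin ℓ → ℝ) :=
  (MeasurableEquiv.piCongrLeft (fun _ : Fin ℓ => ℝ) (rankCoord π)).symm

/-- `compRankCoord π h = h ∘ rankCoord π`. -/
@[simp] theorem compRankCoord_apply (π : Equiv.Perm (Fin (ℓ + 1))) (h : Fin ℓ → ℝ) :
    compRankCoord π h = h ∘ rankCoord π := rfl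

/-- The relabelling preserves Lebesgue measure. -/
theorem measurePreserving_compRankCoord (π : Equiv.Perm (Fin (ℓ + 1))) :
    MeasurePreserving (compRankCoord π) volume volume :=
  (volume_measurePreserving_piCongrLeft (fun _ : Fin ℓ => ℝ) (rankCoord π)).symm

/-! ### The sector function on gap vectors -/

variable {ι : Type*} [Fintype ι] (E : EdgeFamily ℓ ι) (c : ι → ℝ) (π : Equiv.Perm (Fin (ℓ + 1)))

/-- The set of gap vectors sorted along `π`. -/
def sortedSet (π : Equiv.Perm (Fin (ℓ + 1))) : Set (Fin (ℓ + 1) → ℝ) := {g | EdgeFamily.Sorted π g}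

/-- `sortedSet π` is measurable. -/
theorem measurableSet_sortedSet : MeasurableSet (sortedSet π) := by
  have : sortedSet π = ⋂ a : Fin (ℓ + 1), ⋂ b : Fin (ℓ + 1), {g | a ≤ b → g (π a) ≤ g (π b)} := by
    ext g; simp [sortedSet, EdgeFamily.Sorted, Monotone]
  rw [this]
  refine MeasurableSet.iInter fun a => MeasurableSet.iInter fun b => ?_
  by_cases hab : a ≤ b
  · have : {g : Fin (ℓ + 1) → ℝ | a ≤ b → g (π a) ≤ g (π b)} = {g | g (π a) ≤ g (π b)} := by ext; simp [hab]
    rw [this]; exact measurableSet_le (measurable_pi_apply _) (measurable_pi_apply _)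
  · have : {g : Fin (ℓ + 1) → ℝ | a ≤ b → g (π a) ≤ g (π b)} = univ := by ext; simp [hab]
    rw [this]; exact MeasurableSet.univ

namespace EdgeFamily

/-- `aggMono` is measurable. -/
theorem measurable_aggMono : Measurable (E.aggMono π c) := by
  unfold aggMono
  exact Finset.measurable_prod _ fun w _ => (measurable_pi_apply w).pow_const _

/-- The sector function `Ψ_π(g) = 𝟙[g sorted along π]·∏_w g_w^{A_π(w)}` (as `ℝ≥0∞`). -/
def sectorFun (g : Fin (ℓ + 1) → ℝ) : ℝ≥0∞ := (sortedSet π).indicator (fun g => ENNReal.ofReal (E.aggMono π c g)) g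

/-- The sector function is measurable. -/
theorem measurable_sectorFun : Measurable (E.sectorFun c π) :=
  (E.measurable_aggMono c π).ennreal_ofReal.indicator (measurableSet_sortedSet π)

/-- The gap map `t ↦ (gapN t w)_w` is measurable. -/
theorem measurable_gaps : Measurable fun t : Fin ℓ → ℝ => fun w : Fin (ℓ + 1) => gapN t w :=
  measurable_pi_iff.2 fun _ => ((continuous_pt _).sub (continuous_pt _)).measurable

/-- **Sector cover**: on the simplex, `powProd ≤ Σ_π Kup · Ψ_π(gaps)`. -/
theorem ofReal_powProd_le_sum {t : Fin ℓ → ℝ} (ht : t ∈ openSimplex ℓ) :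
    ENNReal.ofReal (E.powProd c t) ≤
      ∑ π : Equiv.Perm (Fin (ℓ + 1)), ENNReal.ofReal (Kup ℓ c) * E.sectorFun c π (fun w => gapN t w) := by
  obtain ⟨π₀, hπ₀⟩ := exists_sorted (fun w : Fin (ℓ + 1) => gapN t w)
  refine le_trans ?_ (Finset.single_le_sum (fun π _ => zero_le) (Finset.mem_univ π₀))
  rw [sectorFun, indicator_of_mem (show (fun w : Fin (ℓ + 1) => gapN t w) ∈ sortedSet π₀ from hπ₀),
    ← ENNReal.ofReal_mul (le_of_lt (lt_of_lt_of_le (Klo_pos (ℓ := ℓ) c) ?_))]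
  · exact ENNReal.ofReal_le_ofReal (E.powProd_le_aggMono π₀ c ht hπ₀)
  · exact Finset.prod_le_prod (fun i _ => (lt_min one_pos (Real.rpow_pos_of_pos (by positivity) _)).le)
      fun i _ => min_le_of_left_le (le_max_left _ _)

/-! ### The rank exponents and the transfer to the ordered sector -/

/-- The exponents of the free gaps ordered by rank: `e_k = A_π(π (castSucc k))`. -/
def rankExp (k : Fin ℓ) : ℝ := E.aggExp π c (π (Fin.castSucc k))

/-- The tail partial sums of the rank exponents are block functionals of the low-rank gap sets. -/
theorem psum_rankExp (j : Fin ℓ) :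
    ((j : ℝ) + 1) + psum (E.rankExp c π) j = E.blockSum c (lowGaps π (Fin.castSucc j)) := by
  have hsum : psum (E.rankExp c π) j =
      ∑ k : Fin (ℓ + 1), (if k ≤ Fin.castSucc j then E.aggExp π c (π k) else 0) := by
    unfold psum rankExp
    rw [Fin.sum_univ_castSucc]
    simp only [Fin.castSucc_le_castSucc_iff]
    have : ¬ Fin.last ℓ ≤ Fin.castSucc j := not_le.2 (Fin.castSucc_lt_last j)
    rw [if_neg this, add_zero]
  have hblock := E.psum_aggExp_eq_blockSum π c (Fin.castSucc j)
  have hc : ((Fin.castSucc j : Fin (ℓ + 1)) : ℝ) = (j : ℝ) := by rw [Fin.val_castSucc]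
  rw [hsum, ← hblock, hc]

/-- The tail conditions of the rank exponents are block functionals: criterion ⇒ `TailOK (rankExp)`. -/
theorem tailOK_rankExp_of_crit {c : ι → ℝ} (hc : E.Crit c) : TailOK (E.rankExp c π) := by
  intro j
  have hpos : 0 < E.blockSum c (lowGaps π (Fin.castSucc j)) :=
    E.blockSum_pos_of_crit' hc _ (Finset.card_pos.1 (by rw [card_lowGaps]; exact Nat.succ_pos _))
      (by rw [card_lowGaps, Fin.val_castSucc]; exact j.isLt)
  linarith [E.psum_rankExp c π j]

variable {c π}

/-- Values of `extGap (π last) h` on the free gaps, read through the relabelling. -/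
theorem extGap_apply_rank (h : Fin ℓ → ℝ) (k : Fin ℓ) :
    extGap (π (Fin.last ℓ)) h (π (Fin.castSucc k)) = h (rankCoord π k) := by
  unfold extGap
  rw [← succAbove_rankCoord, Fin.insertNth_apply_succAbove]

/-- Value of `extGap (π last) h` on the top gap. -/
theorem extGap_apply_top (h : Fin ℓ → ℝ) : extGap (π (Fin.last ℓ)) h (π (Fin.last ℓ)) = 1 - ∑ j, h j := by
  unfold extGap
  rw [Fin.insertNth_apply_same]

/-- The full gap vector sums to `1`. -/
theorem sum_extGap (wstar : Fin (ℓ + 1)) (h : Fin ℓ → ℝ) : ∑ w, extGap wstar h w = 1 := by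
  unfold extGap
  rw [Fin.sum_univ_succAbove _ wstar, Fin.insertNth_apply_same]
  simp only [Fin.insertNth_apply_succAbove]
  ring

/-- On a sorted gap vector summing to `1`, the top gap is at least `1/(ℓ+1)`. -/
theorem top_gap_ge (h : Fin ℓ → ℝ) (hs : Sorted π (extGap (π (Fin.last ℓ)) h)) :
    1 / (ℓ + 1 : ℝ) ≤ extGap (π (Fin.last ℓ)) h (π (Fin.last ℓ)) := by
  set g := extGap (π (Fin.last ℓ)) h with hg
  have hle : ∀ k : Fin (ℓ + 1), g (π k) ≤ g (π (Fin.last ℓ)) := fun k => hs (Fin.le_last k)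
  have hsum : ∑ k : Fin (ℓ + 1), g (π k) = 1 := by rw [Equiv.sum_comp π g, hg, sum_extGap]
  have : (1 : ℝ) ≤ (ℓ + 1 : ℝ) * g (π (Fin.last ℓ)) := by
    calc (1 : ℝ) = ∑ k : Fin (ℓ + 1), g (π k) := hsum.symm
      _ ≤ ∑ _k : Fin (ℓ + 1), g (π (Fin.last ℓ)) := Finset.sum_le_sum fun k _ => hle k
      _ = (ℓ + 1 : ℝ) * g (π (Fin.last ℓ)) := by simp [Finset.sum_const, Finset.card_univ, Fintype.card_fin]
  rw [div_le_iff₀ (by positivity)]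
  linarith

/-- The sector monomial splits off the top gap: `aggMono g = g(top)^{A(top)} · mono (rankExp) (h ∘ ρ)`. -/
theorem aggMono_extGap_eq (h : Fin ℓ → ℝ) :
    E.aggMono π c (extGap (π (Fin.last ℓ)) h) =
      extGap (π (Fin.last ℓ)) h (π (Fin.last ℓ)) ^ E.aggExp π c (π (Fin.last ℓ)) *
        mono (E.rankExp c π) (h ∘ rankCoord π) := by
  unfold aggMono mono rankExp
  rw [← Equiv.prod_comp π (fun w => extGap (π (Fin.last ℓ)) h w ^ E.aggExp π c w), Fin.prod_univ_castSucc,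
    mul_comm]
  congr 1
  refine Finset.prod_congr rfl fun k _ => ?_
  rw [Function.comp_apply, extGap_apply_rank]

/-- Bound for the power of the top gap: `d ∈ [1/(ℓ+1), 1]` ⇒ `d^A ≤ max 1 ((1/(ℓ+1))^A)`. -/
theorem rpow_top_le {d : ℝ} (h1 : 1 / (ℓ + 1 : ℝ) ≤ d) (h2 : d ≤ 1) (A : ℝ) :
    d ^ A ≤ max 1 ((1 / (ℓ + 1 : ℝ)) ^ A) := by
  have hm : (0 : ℝ) < 1 / (ℓ + 1 : ℝ) := by positivity
  rcases le_or_gt 0 A with hA | hA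
  · exact (Real.rpow_le_one (hm.le.trans h1) h2 hA).trans (le_max_left _ _)
  · exact (Real.rpow_le_rpow_of_nonpos hm h1 hA.le).trans (le_max_right _ _)

/-- **Transfer to the ordered sector** (pointwise, on the gap region): for `h ∈ gapSet` with `extGap (π last) h`
sorted along `π`, the relabelled free gaps lie in `sectorSet ℓ 1` and
`Ψ_π(extGap h) ≤ Ktop · mono (rankExp) (h ∘ ρ)`. -/
theorem sectorFun_extGap_le (h : Fin ℓ → ℝ) :
    (gapSet ℓ).indicator (fun h => E.sectorFun c π (extGap (π (Fin.last ℓ)) h)) h ≤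
      ENNReal.ofReal (max 1 ((1 / (ℓ + 1 : ℝ)) ^ E.aggExp π c (π (Fin.last ℓ)))) *
        (compRankCoord π ⁻¹' sectorSet ℓ 1).indicator (fun h => ENNReal.ofReal (mono (E.rankExp c π) (h ∘ rankCoord π))) h := by
  by_cases hh : h ∈ gapSet ℓ
  · rw [indicator_of_mem hh, sectorFun]
    by_cases hs : extGap (π (Fin.last ℓ)) h ∈ sortedSet π
    · have hs' : Sorted π (extGap (π (Fin.last ℓ)) h) := hs
      -- the relabelled free gaps are in the ordered sector
      have hmem : h ∈ compRankCoord π ⁻¹' sectorSet ℓ 1 := by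
        rw [Set.mem_preimage, compRankCoord_apply]
        refine ⟨fun k => hh.1 _, fun k => ?_, fun k k' hkk' => ?_⟩
        · have := Finset.single_le_sum (fun j _ => (hh.1 j).le) (Finset.mem_univ (rankCoord π k))
          exact le_of_lt (lt_of_le_of_lt this hh.2)
        · have := hs' (Fin.castSucc_le_castSucc_iff.2 hkk')
          simpa only [Function.comp_apply, extGap_apply_rank] using this
      rw [indicator_of_mem hs, indicator_of_mem hmem, aggMono_extGap_eq,
        ENNReal.ofReal_mul (Real.rpow_nonneg (le_trans (by positivity) (top_gap_ge h hs')) _)]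
      gcongr
      refine rpow_top_le (top_gap_ge h hs') ?_ _
      rw [extGap_apply_top]
      linarith [Finset.sum_nonneg fun j (_ : j ∈ Finset.univ) => (hh.1 j).le]
    · rw [indicator_of_notMem hs]; exact zero_le
  · rw [indicator_of_notMem hh]; exact zero_le

variable (c π)

/-- **The sector integral is finite** under the criterion. -/
theorem lintegral_sectorFun_lt_top {c : ι → ℝ} (hc : E.Crit c) :
    ∫⁻ t in openSimplex ℓ, E.sectorFun c π (fun w => gapN t w) < ⊤ := by
  rw [lintegral_openSimplex_eq_gapSet_extGap (E.sectorFun c π) (E.measurable_sectorFun c π) (π (Fin.last ℓ)),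
    ← lintegral_indicator (measurableSet_gapSet ℓ)]
  have hSm : MeasurableSet (compRankCoord π ⁻¹' sectorSet ℓ 1) :=
    (measurableSet_sectorSet ℓ 1).preimage (compRankCoord π).measurable
  have hFm : Measurable fun h : Fin ℓ → ℝ => ENNReal.ofReal (mono (E.rankExp c π) (h ∘ rankCoord π)) :=
    ((measurable_mono _).comp (compRankCoord π).measurable).ennreal_ofReal
  refine lt_of_le_of_lt (lintegral_mono fun h => E.sectorFun_extGap_le h) ?_
  rw [lintegral_const_mul _ (hFm.indicator hSm), lintegral_indicator hSm]
  refine ENNReal.mul_lt_top ENNReal.ofReal_lt_top ?_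
  have := (measurePreserving_compRankCoord π).setLIntegral_comp_preimage (measurableSet_sectorSet ℓ 1)
    ((measurable_mono (E.rankExp c π)).ennreal_ofReal)
  simp only [compRankCoord_apply] at this
  rw [this]
  exact (lintegral_sectorSet_mono_lt_top_iff ℓ one_pos _).2 (E.tailOK_rankExp_of_crit π hc)

/-- **Sufficiency of the criterion**: `∫_{simplex} ∏_i len_i^{c_i} < ∞`. [Brown2016, §2.4 / Lemma 3.6, analytic half,
direction "no poles ⇒ convergence", for products of powers of point differences] -/
theorem lintegral_powProd_lt_top_of_crit {c : ι → ℝ} (hc : E.Crit c) :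
    ∫⁻ t in openSimplex ℓ, ENNReal.ofReal (E.powProd c t) < ⊤ := by
  have hmeas0 : ∀ π : Equiv.Perm (Fin (ℓ + 1)),
      Measurable fun t : Fin ℓ → ℝ => E.sectorFun c π (fun w => gapN t w) :=
    fun π => (E.measurable_sectorFun c π).comp measurable_gaps
  have hmeas : ∀ π : Equiv.Perm (Fin (ℓ + 1)),
      Measurable fun t : Fin ℓ → ℝ => ENNReal.ofReal (Kup ℓ c) * E.sectorFun c π (fun w => gapN t w) :=
    fun π => (hmeas0 π).const_mul _
  calc ∫⁻ t in openSimplex ℓ, ENNReal.ofReal (E.powProd c t)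
      ≤ ∫⁻ t in openSimplex ℓ, ∑ π : Equiv.Perm (Fin (ℓ + 1)),
          ENNReal.ofReal (Kup ℓ c) * E.sectorFun c π (fun w => gapN t w) :=
        setLIntegral_mono (Finset.measurable_sum _ fun π _ => hmeas π) fun t ht => E.ofReal_powProd_le_sum c ht
    _ = ∑ π : Equiv.Perm (Fin (ℓ + 1)), ∫⁻ t in openSimplex ℓ,
          ENNReal.ofReal (Kup ℓ c) * E.sectorFun c π (fun w => gapN t w) :=
        lintegral_finsetSum _ fun π _ => hmeas π
    _ < ⊤ := by
        refine ENNReal.sum_lt_top.2 fun π _ => ?_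
        rw [lintegral_const_mul _ (hmeas0 π)]
        exact ENNReal.mul_lt_top ENNReal.ofReal_lt_top (E.lintegral_sectorFun_lt_top π hc)

/-- **Sufficiency of the criterion, integrability form**: `powProd` is integrable on the open simplex. -/
theorem integrableOn_powProd_of_crit {c : ι → ℝ} (hc : E.Crit c) : IntegrableOn (E.powProd c) (openSimplex ℓ) := by
  refine ⟨(E.measurable_powProd c).aestronglyMeasurable, ?_⟩
  rw [hasFiniteIntegral_iff_ofReal]
  · exact E.lintegral_powProd_lt_top_of_crit hc
  · exact (ae_restrict_iff' (measurableSet_openSimplex ℓ)).2 (ae_of_all _ fun t ht => (E.powProd_pos c ht).le)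

end EdgeFamily

end Summit.KontsevichZagierPeriods.Zeta5Search.Families.Cellular
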